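import Summits.Ventures.CertifiedManyBodySolver.Upper.IntervalReaderSourcedClaimNode

/-!
# Ventures/CertifiedManyBodySolver — Upper/IntervalReaderSourcedTwoFieldNode.lean: bytes ⇒ THE W5 TWO-FIELD CLAIM NODE
(part 32 of the Theorem-H1′ package; parts 1–31: `IntervalReaderSchur` … `IntervalReaderSourcedClaimNode`)

HONEST FRAMING: first certified bounds; not a superconductivity verdict; every number certified (two readers)
or labelled float.  A sourced-Hamiltonian upper with a zero-field energy window is a pair of certified variational
statements about ONE finite-box vector; it is never a sign of order and never an order-parameter word
(LADDER v1.17 (i)).  This file composes already-landed theorems; it certifies no number and moves no row.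

THE SEVEN-CONJUNCT NODE.  The W5 «two-field» rows (`Certificates/…sourced_openbox…_twoField.lean`, hubbard-cq-obsth-2's
shape) add to the five conjuncts of part 31 the ZERO-FIELD energy window of the SAME vector,
`e0_lo·ab ≤ Re⟨ψ, A_C(μ, 0) ψ⟩ ≤ e0_hi·ab` — the sgf reader's third row (`E_mu0`, FORMAT-mpsgf1 `observables`), read
by one more multi-state sweep over ird-3's automaton for the `h = 0` transformed operator.  A window needs BOTH
edges, so part 22's one-sided sentence is generalised first:

* `quadraticWindow_of_reader` — for any symmetric `M` and monotone `e`: bytes of the `H`-sweep over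
  `quadAutomaton (dGammaHop (orbPullback e M)) 0 (quadOnSite M U μ e)` and of the `Nrm`-sweep + FOUR by-value corner
  tests ⟹ `E_lo·Re⟨ψ̃,ψ̃⟩ ≤ Re⟨ψ̃, (dΓ(M) − μ·ab·1 + U(N_↑ − Σ n_↑n_↓)) ψ̃⟩ ≤ E_hi·Re⟨ψ̃,ψ̃⟩`
  (parts 20/22 enclosure + part 23's `lower_sound` + part 3's `accept_sound`);
* **`producersSourcedBoxTwoFieldNode_of_reader`** — PRODUCTION FRAME (`g = ±1`): the hypotheses of part 31's
  `producersSourcedBoxNode_of_reader` plus the `H̃₀`-sweep (the same automaton at `h = 0`) with its four window tests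
  against `e0_lo·ab`, `e0_hi·ab` ⟹ the seven-conjunct node of `Upper.sourcedBoxTwoFieldNode_of_gaugedShibaWitness'`
  — the body of `cert_sgf_openbox32x4_U8_mu7o4_k3o7_j264564_twoField` up to `HasParity.mono`.

Inputs outside the bytes, unchanged: the contractions (kit), the machine premises (A1)/(A2), the code tables =
`quadAutomaton` by value, the F-V2 labels and `n_lo > 0` by value.
-/

noncomputable section

open Matrix Finset WithLp
open scoped BigOperators ComplexOrder Matrix.Norms.L2Operator

namespace Summit.Ventures.CertifiedManyBodySolver.Upper.IntervalReader

open Literature.MathematicalPhysics.QuantumLattice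
open Literature.MathematicalPhysics.QuantumLattice.JordanWigner
open Literature.MathematicalPhysics.QuantumLattice.TwoCluster (HasParity)

/-! ## §XX  A two-sided window for the transformed quadratic-plus-Hubbard operator -/

section Window

variable {a b D : ℕ}

/-- **Bytes of the `l3core-sgf` reader ⇒ a WINDOW for the transformed energy** (any symmetric `M`, monotone `e`):
the `H`-sweep and `Nrm`-sweep hypotheses of part 22's `quadratic_sentence_of_reader` and four by-value corner tests
(`hlo1`/`hlo2` for the lower edge `E_lo`, `hhi1`/`hhi2` for the upper edge `E_hi`) give
`E_lo·Re⟨ψ̃,ψ̃⟩ ≤ Re⟨ψ̃, (dΓ(M) − μ·ab·1 + U(N_↑ − Σ n_↑n_↓)) ψ̃⟩ ≤ E_hi·Re⟨ψ̃,ψ̃⟩`. -/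
theorem quadraticWindow_of_reader (M : Matrix (Orb (Fin a ×ₗ Fin b)) (Orb (Fin a ×ₗ Fin b)) ℂ)
    (hM : ∀ i j, M i j = M j i) (U μ : ℝ) (e : Fin (a * b) ≃ (Fin a ×ₗ Fin b))
    (he : ∀ i j, e i < e j ↔ i < j) (A : Fin (a * b) → MPSTensor 4 D) (l r : Fin D → ℂ)
    (κ : Fin (a * b) → ℝ) (hκ0 : ∀ k, 0 ≤ κ k)
    (hκ : ∀ k (z : EuclideanSpace ℂ (Fin D)), ∑ s, ‖toLp 2 (A k s *ᵥ ofLp z)‖ ^ 2 ≤ κ k * ‖z‖ ^ 2)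
    (Mo : Fin (a * b) → QState (a * b) → QState (a * b) → ℝ) (hM0 : ∀ k b' c, 0 ≤ Mo k b' c)
    (hMrow : ∀ k b' c s, ∑ s', ‖quadAutomaton (dGammaHop (orbPullback e M)) (fun _ _ _ _ => 0)
      (quadOnSite M U μ e) k b' c s s'‖ ≤ Mo k b' c)
    (hMcol : ∀ k b' c s', ∑ s, ‖quadAutomaton (dGammaHop (orbPullback e M)) (fun _ _ _ _ => 0)
      (quadOnSite M U μ e) k b' c s s'‖ ≤ Mo k b' c)
    (YH : Fin (a * b + 1) → QState (a * b) → Matrix (Fin D) (Fin D) ℂ) (ρH : Fin (a * b) → QState (a * b) → ℝ)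
    (hρH : ∀ (k : Fin (a * b)) (c : QState (a * b)),
      ‖YH k.succ c - ∑ b', transferOp (A k) (quadAutomaton (dGammaHop (orbPullback e M)) (fun _ _ _ _ => 0)
        (quadOnSite M U μ e) k b' c) (YH k.castSucc b')‖ ≤ ρH k c)
    (radH : Fin (a * b + 1) → QState (a * b) → ℝ)
    (hrH0 : ∀ b', ‖YH 0 b' -
      (Pi.single QState.start (vecMulVec (star l) l) : QState (a * b) → Matrix (Fin D) (Fin D) ℂ) b'‖ ≤ radH 0 b')
    (hrH : ∀ (k : Fin (a * b)) (c : QState (a * b)),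
      ∑ b', Mo k b' c * κ k * radH k.castSucc b' + ρH k c ≤ radH k.succ c)
    (YN : Fin (a * b + 1) → Matrix (Fin D) (Fin D) ℂ) (ρN : Fin (a * b) → ℝ)
    (hρN : ∀ k : Fin (a * b), ‖YN k.succ - transferOp (A k) 1 (YN k.castSucc)‖ ≤ ρN k)
    (radN : Fin (a * b + 1) → ℝ) (hrN0 : ‖YN 0 - vecMulVec (star l) l‖ ≤ radN 0)
    (hrN : ∀ k : Fin (a * b), 1 * κ k * radN k.castSucc + ρN k ≤ radN k.succ)
    (Elo Ehi : ℝ)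
    (hlo1 : Elo * ((star r ⬝ᵥ (YN (Fin.last (a * b)) *ᵥ r)).re - (∑ i, ‖r i‖) * (∑ i, ‖r i‖) * radN (Fin.last (a * b)))
      ≤ (star r ⬝ᵥ (YH (Fin.last (a * b)) QState.fin *ᵥ r)).re -
        (∑ i, ‖r i‖) * (∑ i, ‖r i‖) * radH (Fin.last (a * b)) QState.fin)
    (hlo2 : Elo * ((star r ⬝ᵥ (YN (Fin.last (a * b)) *ᵥ r)).re + (∑ i, ‖r i‖) * (∑ i, ‖r i‖) * radN (Fin.last (a * b)))
      ≤ (star r ⬝ᵥ (YH (Fin.last (a * b)) QState.fin *ᵥ r)).re -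
        (∑ i, ‖r i‖) * (∑ i, ‖r i‖) * radH (Fin.last (a * b)) QState.fin)
    (hhi1 : (star r ⬝ᵥ (YH (Fin.last (a * b)) QState.fin *ᵥ r)).re +
        (∑ i, ‖r i‖) * (∑ i, ‖r i‖) * radH (Fin.last (a * b)) QState.fin ≤
      Ehi * ((star r ⬝ᵥ (YN (Fin.last (a * b)) *ᵥ r)).re - (∑ i, ‖r i‖) * (∑ i, ‖r i‖) * radN (Fin.last (a * b))))
    (hhi2 : (star r ⬝ᵥ (YH (Fin.last (a * b)) QState.fin *ᵥ r)).re +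
        (∑ i, ‖r i‖) * (∑ i, ‖r i‖) * radH (Fin.last (a * b)) QState.fin ≤
      Ehi * ((star r ⬝ᵥ (YN (Fin.last (a * b)) *ᵥ r)).re + (∑ i, ‖r i‖) * (∑ i, ‖r i‖) * radN (Fin.last (a * b)))) :
    let Ψ : TensorIndex (Fin a ×ₗ Fin b) 4 → ℂ := fun k => mpsOpenVar (a * b) A l r (fun i => k (e i))
    Elo * (star (toSpinVec.symm Ψ) ⬝ᵥ toSpinVec.symm Ψ).re ≤
        (star (toSpinVec.symm Ψ) ⬝ᵥ
          ((dGamma M - ((μ : ℂ) * ((a : ℂ) * (b : ℂ))) •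
              (1 : Matrix (Finset (Orb (Fin a ×ₗ Fin b))) (Finset (Orb (Fin a ×ₗ Fin b))) ℂ) +
            (U : ℂ) • ((∑ x : Fin a ×ₗ Fin b, numberOp x 0) -
              ∑ x : Fin a ×ₗ Fin b, numberOp x 0 * numberOp x 1)) *ᵥ toSpinVec.symm Ψ)).re ∧
      (star (toSpinVec.symm Ψ) ⬝ᵥ
          ((dGamma M - ((μ : ℂ) * ((a : ℂ) * (b : ℂ))) •
              (1 : Matrix (Finset (Orb (Fin a ×ₗ Fin b))) (Finset (Orb (Fin a ×ₗ Fin b))) ℂ) +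
            (U : ℂ) • ((∑ x : Fin a ×ₗ Fin b, numberOp x 0) -
              ∑ x : Fin a ×ₗ Fin b, numberOp x 0 * numberOp x 1)) *ᵥ toSpinVec.symm Ψ)).re ≤
        Ehi * (star (toSpinVec.symm Ψ) ⬝ᵥ toSpinVec.symm Ψ).re := by
  intro Ψ
  have hEq := inner_quadratic_eq_quadWordSum M hM U μ e he A l r
  have hNq : star (toSpinVec.symm Ψ) ⬝ᵥ toSpinVec.symm Ψ =
      star (mpsOpenVar (a * b) A l r) ⬝ᵥ mpsOpenVar (a * b) A l r := by
    rw [← star_toSpinVec_dotProduct, LinearEquiv.apply_symm_apply, star_compEquiv_dotProduct]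
  rw [hEq, hNq]
  have hH := reader_encloses_quadWordSum_element (dGammaHop (orbPullback e M)) (fun _ _ _ _ => 0)
    (quadOnSite M U μ e) A κ hκ0 hκ Mo hM0 hMrow hMcol l l r r YH ρH hρH radH hrH0 hrH
  have hNrm := reader_encloses_productOp_element (a * b) A (fun _ => (1 : Matrix (Fin 4) (Fin 4) ℂ)) κ hκ0 hκ
    (fun _ => (1 : ℝ)) (fun _ => zero_le_one) (fun _ s => (sum_norm_one_apply_row s).le)
    (fun _ s' => (sum_norm_one_apply_col s').le) (1 : Op (Fin (a * b)) 4) one_apply_eq_prod_one l l r r YN ρN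
    hρN radN hrN0 hrN
  rw [Matrix.one_mulVec] at hNrm
  have hA := abs_re_sub_re_le_of_norm_sub_le hH
  have hB := abs_re_sub_re_le_of_norm_sub_le hNrm
  refine ⟨lower_sound hB hA hlo1 hlo2, ?_⟩
  rw [← one_mul ((star (mpsOpenVar (a * b) A l r) ⬝ᵥ
    (quadWordSum (dGammaHop (orbPullback e M)) (fun _ _ _ _ => 0) (quadOnSite M U μ e) *ᵥ
      mpsOpenVar (a * b) A l r)).re)] at hA
  rw [← one_mul Ehi] at hhi1 hhi2
  exact accept_sound one_pos hB hA hhi1 hhi2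

end Window

/-! ## §YY  The seven-conjunct two-field claim node from the reader's bytes -/

section TwoField

variable {a b D : ℕ}

/-- **THE W5 TWO-FIELD CLAIM NODE, PRODUCERS' FRAME** (real sign gauge `g i = ±1`).  Hypotheses: those of part 31's
`producersSourcedBoxNode_of_reader` (the `H̃`-sweep with the ACCEPT test vs `e·ab`, the `Ñ`-sweep with its window
tests vs `n_lo·ab` / `n_hi·ab`, the shared `Nrm`-sweep, `n_lo > 0`, F-V2 labels) PLUS the `H̃₀`-sweep — the same
automaton at `h = 0` (`Mz …, YZ …, radZ …`) — with its four window tests vs `e0_lo·ab` / `e0_hi·ab`.  Conclusion: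
the seven-conjunct node of `Upper.sourcedBoxTwoFieldNode_of_gaugedShibaWitness'` (parity `Ñ + ab`). -/
theorem producersSourcedBoxTwoFieldNode_of_reader (U μ h : ℝ) (eQ nlo nhi e0lo e0hi : ℚ)
    {g : Orb (Fin a ×ₗ Fin b) → ℂ} (hg : ∀ i, g i = 1 ∨ g i = -1) (e : Fin (a * b) ≃ (Fin a ×ₗ Fin b))
    (he : ∀ i j, e i < e j ↔ i < j) (A : Fin (a * b) → MPSTensor 4 D) (l r : Fin D → ℂ)
    (κ : Fin (a * b) → ℝ) (hκ0 : ∀ k, 0 ≤ κ k)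
    (hκ : ∀ k (z : EuclideanSpace ℂ (Fin D)), ∑ s, ‖toLp 2 (A k s *ᵥ ofLp z)‖ ^ 2 ≤ κ k * ‖z‖ ^ 2)
    -- the `H̃`-sweep (field `h`)
    (Mo : Fin (a * b) → QState (a * b) → QState (a * b) → ℝ) (hM0 : ∀ k b' c, 0 ≤ Mo k b' c)
    (hMrow : ∀ k b' c s, ∑ s', ‖quadAutomaton (dGammaHop (orbPullback e
      (Matrix.of fun i j => star (g i) * g j * w5Nambu a b μ h i j))) (fun _ _ _ _ => 0)
      (quadOnSite (Matrix.of fun i j => star (g i) * g j * w5Nambu a b μ h i j) U μ e) k b' c s s'‖ ≤ Mo k b' c)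
    (hMcol : ∀ k b' c s', ∑ s, ‖quadAutomaton (dGammaHop (orbPullback e
      (Matrix.of fun i j => star (g i) * g j * w5Nambu a b μ h i j))) (fun _ _ _ _ => 0)
      (quadOnSite (Matrix.of fun i j => star (g i) * g j * w5Nambu a b μ h i j) U μ e) k b' c s s'‖ ≤ Mo k b' c)
    (YH : Fin (a * b + 1) → QState (a * b) → Matrix (Fin D) (Fin D) ℂ) (ρH : Fin (a * b) → QState (a * b) → ℝ)
    (hρH : ∀ (k : Fin (a * b)) (c : QState (a * b)),
      ‖YH k.succ c - ∑ b', transferOp (A k) (quadAutomaton (dGammaHop (orbPullback e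
        (Matrix.of fun i j => star (g i) * g j * w5Nambu a b μ h i j))) (fun _ _ _ _ => 0)
        (quadOnSite (Matrix.of fun i j => star (g i) * g j * w5Nambu a b μ h i j) U μ e) k b' c)
        (YH k.castSucc b')‖ ≤ ρH k c)
    (radH : Fin (a * b + 1) → QState (a * b) → ℝ)
    (hrH0 : ∀ b', ‖YH 0 b' -
      (Pi.single QState.start (vecMulVec (star l) l) : QState (a * b) → Matrix (Fin D) (Fin D) ℂ) b'‖ ≤ radH 0 b')
    (hrH : ∀ (k : Fin (a * b)) (c : QState (a * b)),
      ∑ b', Mo k b' c * κ k * radH k.castSucc b' + ρH k c ≤ radH k.succ c)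
    -- the `H̃₀`-sweep (field `0`, the SAME witness)
    (Mz : Fin (a * b) → QState (a * b) → QState (a * b) → ℝ) (hMz0 : ∀ k b' c, 0 ≤ Mz k b' c)
    (hMzrow : ∀ k b' c s, ∑ s', ‖quadAutomaton (dGammaHop (orbPullback e
      (Matrix.of fun i j => star (g i) * g j * w5Nambu a b μ 0 i j))) (fun _ _ _ _ => 0)
      (quadOnSite (Matrix.of fun i j => star (g i) * g j * w5Nambu a b μ 0 i j) U μ e) k b' c s s'‖ ≤ Mz k b' c)
    (hMzcol : ∀ k b' c s', ∑ s, ‖quadAutomaton (dGammaHop (orbPullback e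
      (Matrix.of fun i j => star (g i) * g j * w5Nambu a b μ 0 i j))) (fun _ _ _ _ => 0)
      (quadOnSite (Matrix.of fun i j => star (g i) * g j * w5Nambu a b μ 0 i j) U μ e) k b' c s s'‖ ≤ Mz k b' c)
    (YZ : Fin (a * b + 1) → QState (a * b) → Matrix (Fin D) (Fin D) ℂ) (ρZ : Fin (a * b) → QState (a * b) → ℝ)
    (hρZ : ∀ (k : Fin (a * b)) (c : QState (a * b)),
      ‖YZ k.succ c - ∑ b', transferOp (A k) (quadAutomaton (dGammaHop (orbPullback e
        (Matrix.of fun i j => star (g i) * g j * w5Nambu a b μ 0 i j))) (fun _ _ _ _ => 0)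
        (quadOnSite (Matrix.of fun i j => star (g i) * g j * w5Nambu a b μ 0 i j) U μ e) k b' c)
        (YZ k.castSucc b')‖ ≤ ρZ k c)
    (radZ : Fin (a * b + 1) → QState (a * b) → ℝ)
    (hrZ0 : ∀ b', ‖YZ 0 b' -
      (Pi.single QState.start (vecMulVec (star l) l) : QState (a * b) → Matrix (Fin D) (Fin D) ℂ) b'‖ ≤ radZ 0 b')
    (hrZ : ∀ (k : Fin (a * b)) (c : QState (a * b)),
      ∑ b', Mz k b' c * κ k * radZ k.castSucc b' + ρZ k c ≤ radZ k.succ c)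
    -- the `Ñ`-sweep
    (Mn : Fin (a * b) → QState (a * b) → QState (a * b) → ℝ) (hMn0 : ∀ k b' c, 0 ≤ Mn k b' c)
    (hMnrow : ∀ k b' c s, ∑ s', ‖quadAutomaton (fun _ _ _ _ => 0) (fun _ _ _ _ => 0) (numberOnSite a b) k b' c s s'‖ ≤
      Mn k b' c)
    (hMncol : ∀ k b' c s', ∑ s, ‖quadAutomaton (fun _ _ _ _ => 0) (fun _ _ _ _ => 0) (numberOnSite a b) k b' c s s'‖ ≤
      Mn k b' c)
    (YD : Fin (a * b + 1) → QState (a * b) → Matrix (Fin D) (Fin D) ℂ) (ρD : Fin (a * b) → QState (a * b) → ℝ)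
    (hρD : ∀ (k : Fin (a * b)) (c : QState (a * b)),
      ‖YD k.succ c - ∑ b', transferOp (A k) (quadAutomaton (fun _ _ _ _ => 0) (fun _ _ _ _ => 0) (numberOnSite a b)
        k b' c) (YD k.castSucc b')‖ ≤ ρD k c)
    (radD : Fin (a * b + 1) → QState (a * b) → ℝ)
    (hrD0 : ∀ b', ‖YD 0 b' -
      (Pi.single QState.start (vecMulVec (star l) l) : QState (a * b) → Matrix (Fin D) (Fin D) ℂ) b'‖ ≤ radD 0 b')
    (hrD : ∀ (k : Fin (a * b)) (c : QState (a * b)),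
      ∑ b', Mn k b' c * κ k * radD k.castSucc b' + ρD k c ≤ radD k.succ c)
    -- the `Nrm`-sweep (shared)
    (YN : Fin (a * b + 1) → Matrix (Fin D) (Fin D) ℂ) (ρN : Fin (a * b) → ℝ)
    (hρN : ∀ k : Fin (a * b), ‖YN k.succ - transferOp (A k) 1 (YN k.castSucc)‖ ≤ ρN k)
    (radN : Fin (a * b + 1) → ℝ) (hrN0 : ‖YN 0 - vecMulVec (star l) l‖ ≤ radN 0)
    (hrN : ∀ k : Fin (a * b), 1 * κ k * radN k.castSucc + ρN k ≤ radN k.succ)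
    -- by-value tests: energy row vs `e·ab`
    (hElo : (star r ⬝ᵥ (YH (Fin.last (a * b)) QState.fin *ᵥ r)).re +
        (∑ i, ‖r i‖) * (∑ i, ‖r i‖) * radH (Fin.last (a * b)) QState.fin ≤
      ((eQ : ℝ) * ((a : ℝ) * b)) * ((star r ⬝ᵥ (YN (Fin.last (a * b)) *ᵥ r)).re -
        (∑ i, ‖r i‖) * (∑ i, ‖r i‖) * radN (Fin.last (a * b))))
    (hEhi : (star r ⬝ᵥ (YH (Fin.last (a * b)) QState.fin *ᵥ r)).re +
        (∑ i, ‖r i‖) * (∑ i, ‖r i‖) * radH (Fin.last (a * b)) QState.fin ≤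
      ((eQ : ℝ) * ((a : ℝ) * b)) * ((star r ⬝ᵥ (YN (Fin.last (a * b)) *ᵥ r)).re +
        (∑ i, ‖r i‖) * (∑ i, ‖r i‖) * radN (Fin.last (a * b))))
    -- zero-field window vs `e0_lo·ab`, `e0_hi·ab`
    (hz1 : ((e0lo : ℝ) * ((a : ℝ) * b)) * ((star r ⬝ᵥ (YN (Fin.last (a * b)) *ᵥ r)).re -
        (∑ i, ‖r i‖) * (∑ i, ‖r i‖) * radN (Fin.last (a * b))) ≤
      (star r ⬝ᵥ (YZ (Fin.last (a * b)) QState.fin *ᵥ r)).re -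
        (∑ i, ‖r i‖) * (∑ i, ‖r i‖) * radZ (Fin.last (a * b)) QState.fin)
    (hz2 : ((e0lo : ℝ) * ((a : ℝ) * b)) * ((star r ⬝ᵥ (YN (Fin.last (a * b)) *ᵥ r)).re +
        (∑ i, ‖r i‖) * (∑ i, ‖r i‖) * radN (Fin.last (a * b))) ≤
      (star r ⬝ᵥ (YZ (Fin.last (a * b)) QState.fin *ᵥ r)).re -
        (∑ i, ‖r i‖) * (∑ i, ‖r i‖) * radZ (Fin.last (a * b)) QState.fin)
    (hz3 : (star r ⬝ᵥ (YZ (Fin.last (a * b)) QState.fin *ᵥ r)).re +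
        (∑ i, ‖r i‖) * (∑ i, ‖r i‖) * radZ (Fin.last (a * b)) QState.fin ≤
      ((e0hi : ℝ) * ((a : ℝ) * b)) * ((star r ⬝ᵥ (YN (Fin.last (a * b)) *ᵥ r)).re -
        (∑ i, ‖r i‖) * (∑ i, ‖r i‖) * radN (Fin.last (a * b))))
    (hz4 : (star r ⬝ᵥ (YZ (Fin.last (a * b)) QState.fin *ᵥ r)).re +
        (∑ i, ‖r i‖) * (∑ i, ‖r i‖) * radZ (Fin.last (a * b)) QState.fin ≤
      ((e0hi : ℝ) * ((a : ℝ) * b)) * ((star r ⬝ᵥ (YN (Fin.last (a * b)) *ᵥ r)).re +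
        (∑ i, ‖r i‖) * (∑ i, ‖r i‖) * radN (Fin.last (a * b))))
    -- density window vs `n_lo·ab`, `n_hi·ab`
    (hnlo1 : ((nlo : ℝ) * ((a : ℝ) * b)) * ((star r ⬝ᵥ (YN (Fin.last (a * b)) *ᵥ r)).re -
        (∑ i, ‖r i‖) * (∑ i, ‖r i‖) * radN (Fin.last (a * b))) ≤
      (star r ⬝ᵥ (YD (Fin.last (a * b)) QState.fin *ᵥ r)).re -
        (∑ i, ‖r i‖) * (∑ i, ‖r i‖) * radD (Fin.last (a * b)) QState.fin)
    (hnlo2 : ((nlo : ℝ) * ((a : ℝ) * b)) * ((star r ⬝ᵥ (YN (Fin.last (a * b)) *ᵥ r)).re +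
        (∑ i, ‖r i‖) * (∑ i, ‖r i‖) * radN (Fin.last (a * b))) ≤
      (star r ⬝ᵥ (YD (Fin.last (a * b)) QState.fin *ᵥ r)).re -
        (∑ i, ‖r i‖) * (∑ i, ‖r i‖) * radD (Fin.last (a * b)) QState.fin)
    (hnhi1 : (star r ⬝ᵥ (YD (Fin.last (a * b)) QState.fin *ᵥ r)).re +
        (∑ i, ‖r i‖) * (∑ i, ‖r i‖) * radD (Fin.last (a * b)) QState.fin ≤
      ((nhi : ℝ) * ((a : ℝ) * b)) * ((star r ⬝ᵥ (YN (Fin.last (a * b)) *ᵥ r)).re -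
        (∑ i, ‖r i‖) * (∑ i, ‖r i‖) * radN (Fin.last (a * b))))
    (hnhi2 : (star r ⬝ᵥ (YD (Fin.last (a * b)) QState.fin *ᵥ r)).re +
        (∑ i, ‖r i‖) * (∑ i, ‖r i‖) * radD (Fin.last (a * b)) QState.fin ≤
      ((nhi : ℝ) * ((a : ℝ) * b)) * ((star r ⬝ᵥ (YN (Fin.last (a * b)) *ᵥ r)).re +
        (∑ i, ‖r i‖) * (∑ i, ‖r i‖) * radN (Fin.last (a * b))))
    -- the code's assertion `n_lo > 0` and the certificate's F-V2 labels
    (hn : (∑ i, ‖r i‖) * (∑ i, ‖r i‖) * radN (Fin.last (a * b)) < (star r ⬝ᵥ (YN (Fin.last (a * b)) *ᵥ r)).re)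
    (Nt : ℕ) (c : Fin (a * b + 1) → Fin D → ℕ)
    (hcl : ∀ α, l α ≠ 0 → c 0 α = 0) (hcr : ∀ β, r β ≠ 0 → c (Fin.last (a * b)) β = Nt)
    (hcA : ∀ (j : Fin (a * b)) (s : Fin 4) (α β : Fin D),
      A j s α β ≠ 0 → c j.succ β = c j.castSucc α + siteCharge s) :
    ∃ ψ : Fock (Orb (Fin a ×ₗ Fin b)), HasParity (Nt + a * b) ψ ∧ star ψ ⬝ᵥ ψ = 1 ∧
      (star ψ ⬝ᵥ (dWaveSourceOpenBox a b U μ h *ᵥ ψ)).re ≤ ((eQ : ℚ) : ℝ) * ((a : ℝ) * b) ∧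
      ((nlo : ℚ) : ℝ) * ((a : ℝ) * b) ≤ (star ψ ⬝ᵥ (totalNumber *ᵥ ψ)).re ∧
      (star ψ ⬝ᵥ (totalNumber *ᵥ ψ)).re ≤ ((nhi : ℚ) : ℝ) * ((a : ℝ) * b) ∧
      ((e0lo : ℚ) : ℝ) * ((a : ℝ) * b) ≤ (star ψ ⬝ᵥ (dWaveSourceOpenBox a b U μ 0 *ᵥ ψ)).re ∧
      (star ψ ⬝ᵥ (dWaveSourceOpenBox a b U μ 0 *ᵥ ψ)).re ≤ ((e0hi : ℚ) : ℝ) * ((a : ℝ) * b) := by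
  have hg' : ∀ i, ‖g i‖ = 1 := fun i => by rcases hg i with h1 | h1 <;> simp [h1]
  -- the energy row at field `h` (part 22, producers' frame)
  have hE := producersSourcedBox_sentence_of_reader U μ h hg e he A l r κ hκ0 hκ Mo hM0 hMrow hMcol YH ρH hρH radH
    hrH0 hrH YN ρN hρN radN hrN0 hrN ((eQ : ℝ) * ((a : ℝ) * b)) hElo hEhi
  -- the zero-field window (this file), in the producers' frame by `gaugedShiba'_conjTranspose_conj_dWaveSourceOpenBox`
  have hZ := quadraticWindow_of_reader (Matrix.of fun i j => star (g i) * g j * w5Nambu a b μ 0 i j)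
    (gaugedNambu_symm_of_sign μ 0 hg) U μ e he A l r κ hκ0 hκ Mz hMz0 hMzrow hMzcol YZ ρZ hρZ radZ hrZ0 hrZ YN ρN
    hρN radN hrN0 hrN ((e0lo : ℝ) * ((a : ℝ) * b)) ((e0hi : ℝ) * ((a : ℝ) * b)) hz1 hz2 hz3 hz4
  -- the density window (part 23), in the producers' frame
  have hDW := densityWindow_of_reader e A l r κ hκ0 hκ Mn hMn0 hMnrow hMncol YD ρD hρD radD hrD0 hrD YN ρN hρN radN
    hrN0 hrN ((nlo : ℝ) * ((a : ℝ) * b)) ((nhi : ℝ) * ((a : ℝ) * b)) hnlo1 hnlo2 hnhi1 hnhi2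
  rw [← gaugedShiba'_conjTranspose_conj_totalNumber hg'] at hDW
  -- V1 and V3 (part 31)
  have hN := transformedWitness_sector_of_reader e A l r Nt c hcl hcr hcA
  have hpos := transformedWitness_pos_of_reader e A l r κ hκ0 hκ YN ρN hρN radN hrN0 hrN hn
  refine sourcedBoxTwoFieldNode_of_gaugedShibaWitness' a b U μ h eQ nlo nhi e0lo e0hi hg' _ hN hpos hE hDW.1 hDW.2
    ?_ ?_
  · rw [gaugedShiba'_conjTranspose_conj_dWaveSourceOpenBox a b U μ 0 hg']
    exact hZ.1
  · rw [gaugedShiba'_conjTranspose_conj_dWaveSourceOpenBox a b U μ 0 hg']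
    exact hZ.2

end TwoField

end Summit.Ventures.CertifiedManyBodySolver.Upper.IntervalReader

end
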